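import Summits.AtomisticToContinuum.HydrodynamicLimit.Theorems.EnskogAdjointDualityAdjointEnskogTestFamilyRTransferBoundSlice
import Summits.AtomisticToContinuum.HydrodynamicLimit.Theorems.EnskogAdjointDualityAdjointEnskogTestFamilyRTransferBoundWindow
import Summits.AtomisticToContinuum.HydrodynamicLimit.Theorems.EnskogAdjointDualityAdjointEnskogTestFamilyRPairGaussian
import HarnessLib

/-!
# K2R transfer bound VII: the registered stub `stub_transferBound` (G3b)

Route `EnskogAdjointDuality` of `AtomisticToContinuum/HydrodynamicLimit`, crux `AdjointEnskogTestFamilyR`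
(stmt-AtomisticToContinuum-11592, "K2R"), line `birth`, stub `stub_transferBound` (G3b): **the collisional
transfer of momentum and energy through the hydrodynamic part `ψ = α + β·v + γ|v|²/2` of the test function
reproduces the excess-pressure work of hard-sphere Euler**, uniformly in `N` and `s ∈ [0,t]`:
`|½ B_ψ(N,s) + (2π/3) λ_N ε_N ∫ (β·∇W₀ + γ div(W₀ u))| ≤ K λ_N ε_N²` and `|∫ (β·∇W₀ + γ div(W₀ u))| ≤ M`,
`W₀ = Y(σ³ρ) ρ² θ`, given the reduction identity `B_ψ = λ_N T` of G3a (a hypothesis of the stub).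

Proof: the window constants of the Euler background (helper V, `k2r_tb_window`), the Lipschitz constant of
the Gaussian pair integrals (stub B3a (iii), `stub_pairGaussian`), and the slice estimate
`|T/2 + (2π/3) ε I| ≤ K' ε²` (helper VI, `k2r_tb_slice`); then multiply by `λ_N ≥ 0`.  The bound on `I`
is `|β| ‖∇W₀‖ + |γ| |div(W₀u)| ≤ C K + 3 C K` pointwise.

The statement is the body of the skeleton's Prop `TransferBound` VERBATIM, spelled through a file-local
notation (the skeleton's `def` lives in the non-importable `Cruxes/` work file; the gate keys the stub by the
header `stub_transferBound : TransferBound`).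

References: C. Cercignani, R. Illner, M. Pulvirenti, *The Mathematical Theory of Dilute Gases* (1994),
§3.1, §3.3 [CIP1994]; S. Chapman, T. G. Cowling, *The Mathematical Theory of Non-uniform Gases* (1970), §16
(collisional transfer in the Enskog equation).
-/

noncomputable section

open MeasureTheory Metric Set Filter Topology Function
open scoped InnerProductSpace BigOperators

namespace Summit.AtomisticToContinuum.HydrodynamicLimit.Theorems.EnskogAdjointDuality

open Literature.Analysis.FluidPDE Literature.MathematicalPhysics.KineticTheory Literature.Analysis.FunctionSpaces

/-! ## The registered statement -/

section Main

set_option quotPrecheck false in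
/-- The registered statement `TransferBound` of stub `stub_transferBound` (the body of the Prop `TransferBound` of
the birth skeleton of K2R, stmt-AtomisticToContinuum-11592), VERBATIM, as a file-local spelling: the skeleton's
`def` lives in the (non-importable) `Cruxes/` work file, and the gate keys the stub by the header
`stub_transferBound : TransferBound`.  No declaration of that name is created; `stub_transferBound` below
elaborates to exactly this proposition. -/
local notation "TransferBound" =>
  (
    ∀ (η₁ : ℝ), 0 < η₁ → AnalyticOnNhd ℝ Literature.MathematicalPhysics.KineticTheory.hsExcessFreeEnergy (Set.Ioo 0 η₁) →
    ∀ (σ T : ℝ), 0 < σ → σ ≤ 1 → ∀ (ρ θ : ℝ → UnitAddTorus (Fin 3) → ℝ) (u : ℝ → UnitAddTorus (Fin 3) → EuclideanSpace ℝ (Fin 3)),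
    Literature.MathematicalPhysics.KineticTheory.IsHardSphereEulerSolution σ T ρ u θ →
    ∀ t ∈ Set.Ioo 0 T, (∀ s ∈ Set.Icc 0 t, ∀ x, ρ s x * σ ^ 3 < η₁) →
    ∀ (c : ℕ → ℝ → UnitAddTorus (Fin 3) → ℝ × EuclideanSpace ℝ (Fin 3) × ℝ) (κ : ℕ → ℝ → UnitAddTorus (Fin 3) → EuclideanSpace ℝ (Fin 3) → ℝ),
    (∀ N, Continuous (Function.uncurry (c N))) →
    (∀ N, Continuous (fun p : ℝ × UnitAddTorus (Fin 3) × EuclideanSpace ℝ (Fin 3) => κ N p.1 p.2.1 p.2.2)) →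
    ∀ (C : ℝ), (∀ N s x x' v v', ‖c N s x‖ ≤ C ∧ dist (c N s x) (c N s x') ≤ C * dist x x' ∧ |κ N s x v| ≤ C * (1 + ‖v‖ ^ 2) ∧
      |κ N s x v - κ N s x' v'| ≤ C * (1 + ‖v‖ ^ 2 + ‖v'‖ ^ 2) * (dist x x' + ‖v - v'‖)) →
    (let G := Literature.Analysis.FluidPDE.Torus.geometry (Fin 3)
     let ε := fun N : ℕ => Literature.MathematicalPhysics.KineticTheory.hsDiameter σ N
     let lam := fun N : ℕ => (N : ℝ) * ε N ^ 2
     let f := fun (s : ℝ) (x : UnitAddTorus (Fin 3)) (v : EuclideanSpace ℝ (Fin 3)) => ρ s x * Literature.Analysis.FluidPDE.localMaxwellian 1 (θ s x) (u s x) v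
     let Y := fun η : ℝ => 3 / (2 * Real.pi) * deriv Literature.MathematicalPhysics.KineticTheory.hsExcessFreeEnergy η
     let W₀ := fun (s : ℝ) (x : UnitAddTorus (Fin 3)) => Y (σ ^ 3 * ρ s x) * ρ s x ^ 2 * θ s x
     let ψ := fun (N : ℕ) (s : ℝ) (x : UnitAddTorus (Fin 3)) (v : EuclideanSpace ℝ (Fin 3)) => (c N s x).1 + inner ℝ (c N s x).2.1 v + (c N s x).2.2 * ‖v‖ ^ 2 / 2
     let Lψ := fun (N : ℕ) (s : ℝ) (x : UnitAddTorus (Fin 3)) (v : EuclideanSpace ℝ (Fin 3)) => lam N * ∫ ω : Metric.sphere (0 : EuclideanSpace ℝ (Fin 3)) 1, (let y := G.translate x (ε N • (ω : EuclideanSpace ℝ (Fin 3))); ∫ w : EuclideanSpace ℝ (Fin 3), max (inner ℝ (v - w) ω) 0 * Y (σ ^ 3 * ρ s (G.translate x ((ε N / 2) • (ω : EuclideanSpace ℝ (Fin 3))))) * f s y w * (ψ N s x (v - inner ℝ (v - w) ω • (ω : EuclideanSpace ℝ (Fin 3))) + ψ N s y (w + inner ℝ (v - w) ω • (ω : EuclideanSpace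 ℝ (Fin 3))) - ψ N s x v - ψ N s y w)) ∂Literature.MathematicalPhysics.KineticTheory.sphereMeasure
     let Bψ := fun (N : ℕ) (s : ℝ) => ∫ x : UnitAddTorus (Fin 3), ∫ v : EuclideanSpace ℝ (Fin 3), f s x v * Lψ N s x v
     let I := fun (N : ℕ) (s : ℝ) => ∫ x : UnitAddTorus (Fin 3), (inner ℝ (c N s x).2.1 (Literature.Analysis.FunctionSpaces.Torus.gradient (W₀ s) x) + (c N s x).2.2 * Literature.Analysis.FunctionSpaces.Torus.divergence (fun y => W₀ s y • u s y) x)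
     let J₁ := fun (N : ℕ) (s : ℝ) (x : UnitAddTorus (Fin 3)) (ω : Metric.sphere (0 : EuclideanSpace ℝ (Fin 3)) 1) => ∫ v : EuclideanSpace ℝ (Fin 3), ∫ w : EuclideanSpace ℝ (Fin 3), max (inner ℝ (v - w) ω) 0 * inner ℝ (v - w) ω * (Literature.Analysis.FluidPDE.localMaxwellian 1 (θ s x) (u s x) v * Literature.Analysis.FluidPDE.localMaxwellian 1 (θ s (G.translate x (ε N • (ω : EuclideanSpace ℝ (Fin 3))))) (u s (G.translate x (ε N • (ω : EuclideanSpace ℝ (Fin 3))))) w)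
     let J₂ := fun (N : ℕ) (s : ℝ) (x : UnitAddTorus (Fin 3)) (ω : Metric.sphere (0 : EuclideanSpace ℝ (Fin 3)) 1) => ∫ v : EuclideanSpace ℝ (Fin 3), ∫ w : EuclideanSpace ℝ (Fin 3), max (inner ℝ (v - w) ω) 0 * inner ℝ (v - w) ω * (inner ℝ (v + w) ω / 2) * (Literature.Analysis.FluidPDE.localMaxwellian 1 (θ s x) (u s x) v * Literature.Analysis.FluidPDE.localMaxwellian 1 (θ s (G.translate x (ε N • (ω : EuclideanSpace ℝ (Fin 3))))) (u s (G.translate x (ε N • (ω : EuclideanSpace ℝ (Fin 3))))) w)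
     let T := fun (N : ℕ) (s : ℝ) => ∫ ω : Metric.sphere (0 : EuclideanSpace ℝ (Fin 3)) 1, (∫ x : UnitAddTorus (Fin 3), -(Y (σ ^ 3 * ρ s (G.translate x ((ε N / 2) • (ω : EuclideanSpace ℝ (Fin 3))))) * ρ s x * ρ s (G.translate x (ε N • (ω : EuclideanSpace ℝ (Fin 3))))) * (inner ℝ ((c N s x).2.1 - (c N s (G.translate x (ε N • (ω : EuclideanSpace ℝ (Fin 3))))).2.1) ω * J₁ N s x ω + ((c N s x).2.2 - (c N s (G.translate x (ε N • (ω : EuclideanSpace ℝ (Fin 3))))).2.2) * J₂ N s x ω)) ∂Literature.MathematicalPhysics.KineticTheory.sphereMeasure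
     (∀ (N : ℕ), ∀ s ∈ Set.Icc 0 t, Bψ N s = lam N * T N s) →
     ∃ K M : ℝ, ∀ (N : ℕ), ∀ s ∈ Set.Icc 0 t, |(1 / 2 : ℝ) * Bψ N s + (2 * Real.pi / 3) * (lam N * ε N) * I N s| ≤ K * (lam N * ε N ^ 2) ∧ |I N s| ≤ M))

/-- **G3b — the transfer bound at the position × direction level** (registered stub `stub_transferBound :
TransferBound` of the birth line of K2R; the statement is the verbatim body of the skeleton's Prop
`TransferBound`, spelled through the file-local notation above).  Given the reduction identity
`B_ψ(N,s) = λ_N T(N,s)` (G3a), uniformly in `N` and `s ∈ [0,t]`: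
`|½B_ψ + (2π/3)λ_Nε_N I| ≤ K λ_Nε_N²` and `|I| ≤ M`, `I = ∫ (β·∇W₀ + γ div(W₀u))`, `W₀ = Y(σ³ρ)ρ²θ`:
stub B3a (iii) for `J₁, J₂` against the `O(ε)`-Lipschitz background, the contact-factor and `ρ(y)` shifts —
each against the `O(ε)` increment of the Lipschitz coefficients `β, γ` — then stub B3b (i) per component and
(ii) for `∫ωᵢωⱼ dσ = (4π/3)δᵢⱼ`, and `div(W₀u) = ∑ⱼ ∂ⱼ(W₀uⱼ)`. [cite: CIP1994, §3.1] -/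
theorem stub_transferBound : TransferBound := by
  intro η₁ _hη₁ hA σ T hσ hσ1 ρ θ u hEul t ht hguard c κ hc _hκ C hadm G ε lam f Y W₀ ψ Lψ Bψ I J₁ J₂ T hred
  -- window constants of the Euler background, uniformly in `s ∈ [0, t]`
  obtain ⟨R, U, θm, Θ, Lb, Yb, LY, K, hθm, hLb, hLY, hK0, hcont, hbds, hLip, hsm, hG, hGL⟩ :=
    k2r_tb_window hA hσ hσ1 hEul ht hguard
  -- the Lipschitz constant of the Gaussian pair integrals on the parameter range (stub B3a (iii))
  obtain ⟨KJ, hKJ0, hKJ⟩ := stub_pairGaussian.2 θm Θ U hθm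
  have hC : 0 ≤ C := (norm_nonneg _).trans (hadm 0 0 0 0 0 0).1
  -- the constants
  refine ⟨(sphereMeasure : Measure (sphere (0 : V3) 1)).real univ / 2 * (|(2 * (Yb * R * R) * C * (KJ * (2 * Lb)) + (LY * R * R / 2 + Yb * R * Lb) * Θ * C * (1 + U))| + |6 * K * C|),
    C * K + C * (3 * K), fun N s hs => ?_⟩
  -- facts on the scaling
  have hε0 : 0 < ε N := hsDiameter_pos hσ N
  have hε1 : ε N ≤ 1 := (hsDiameter_le hσ.le N).trans hσ1
  have hlam : 0 ≤ lam N := by show 0 ≤ (N : ℝ) * ε N ^ 2; positivity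
  -- the slice data at time `s`
  obtain ⟨hρc, hθc, huc, hYc⟩ := hcont s hs
  have hcc : Continuous (c N s) := (hc N).comp (Continuous.prodMk_right s)
  have hc' : ∀ x x', ‖c N s x‖ ≤ C ∧ dist (c N s x) (c N s x') ≤ C * dist x x' := fun x x' =>
    ⟨(hadm N s x x' 0 0).1, (hadm N s x x' 0 0).2.1⟩
  have hρ : ∀ x, 0 ≤ ρ s x ∧ ρ s x ≤ R := fun x => (hbds s hs x).1
  have hθ : ∀ x, θm ≤ θ s x ∧ θ s x ≤ Θ := fun x => (hbds s hs x).2.1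
  have hu : ∀ x, ‖u s x‖ ≤ U := fun x => (hbds s hs x).2.2.1
  have hY : ∀ x, |Y (σ ^ 3 * ρ s x)| ≤ Yb := fun x => (hbds s hs x).2.2.2
  have hLip' : ∀ x x', |ρ s x - ρ s x'| ≤ Lb * dist x x' ∧ |θ s x - θ s x'| ≤ Lb * dist x x' ∧
      ‖u s x - u s x'‖ ≤ Lb * dist x x' := fun x x' =>
    ⟨(hLip s hs x x').1, (hLip s hs x x').2.1, (hLip s hs x x').2.2.1⟩
  have hYL : ∀ x x', |Y (σ ^ 3 * ρ s x) - Y (σ ^ 3 * ρ s x')| ≤ LY * dist x x' := fun x x' =>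
    (hLip s hs x x').2.2.2
  have hWdef : ∀ x, W₀ s x = (fun x => Y (σ ^ 3 * ρ s x)) x * ρ s x ^ 2 * θ s x := fun x => rfl
  -- (a) the bound on `I`
  have hIb : |I N s| ≤ C * K + C * (3 * K) := by
    have hpt : ∀ x, |⟪(c N s x).2.1, Torus.gradient (W₀ s) x⟫_ℝ +
        (c N s x).2.2 * Torus.divergence (fun y => W₀ s y • u s y) x| ≤ C * K + C * (3 * K) := by
      intro x
      have h1 : |⟪(c N s x).2.1, Torus.gradient (W₀ s) x⟫_ℝ| ≤ C * K :=
        (abs_real_inner_le_norm _ _).trans (mul_le_mul ((k2r_tb_norm_snd_fst_le _).trans (hc' x x).1)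
          (hG s hs x).1 (norm_nonneg _) hC)
      have hdiv : |Torus.divergence (fun y => W₀ s y • u s y) x| ≤ 3 * K := by
        rw [k2r_divergence_smul]
        refine (Finset.abs_sum_le_sum_abs _ _).trans ?_
        calc ∑ i, |Torus.partialDeriv i (fun y => W₀ s y * u s y i) x| ≤ ∑ _i : Fin 3, K :=
              Finset.sum_le_sum fun i _ =>
                (k2r_tb_abs_partialDeriv_le_norm_gradient (((hsm s hs).2 i).isContDiff (by simp)) x i).trans
                  ((hG s hs x).2 i)
          _ = 3 * K := by simp
      have h2 : |(c N s x).2.2 * Torus.divergence (fun y => W₀ s y • u s y) x| ≤ C * (3 * K) := by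
        rw [abs_mul]
        exact mul_le_mul ((k2r_tb_abs_snd_snd_le _).trans (hc' x x).1) hdiv (abs_nonneg _) hC
      exact (abs_add_le _ _).trans (add_le_add h1 h2)
    have h := norm_integral_le_of_norm_le_const (μ := (volume : Measure T3)) (C := C * K + C * (3 * K))
      (f := fun x => ⟪(c N s x).2.1, Torus.gradient (W₀ s) x⟫_ℝ +
        (c N s x).2.2 * Torus.divergence (fun y => W₀ s y • u s y) x)
      (Eventually.of_forall fun x => by rw [Real.norm_eq_abs]; exact hpt x)
    rw [probReal_univ, mul_one, Real.norm_eq_abs] at h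
    exact h
  refine ⟨?_, hIb⟩
  -- (b) the slice estimate and the reduction identity
  have hT : |T N s / 2 + 2 * Real.pi / 3 * ε N * I N s| ≤
      (sphereMeasure : Measure (sphere (0 : V3) 1)).real univ / 2 * (|(2 * (Yb * R * R) * C * (KJ * (2 * Lb)) + (LY * R * R / 2 + Yb * R * Lb) * Θ * C * (1 + U))| + |6 * K * C|) * ε N ^ 2 :=
    k2r_tb_slice hθm hLb hLY hKJ0 hρc hθc huc hYc hcc hρ hθ hu hLip' hY hYL hc' hWdef (hsm s hs).1
      (hsm s hs).2 (hGL s hs · · |>.1) (fun j x x' => (hGL s hs x x').2 j) hKJ hε0 hε1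
  rw [hred N s hs]
  have he : (1 / 2 : ℝ) * (lam N * T N s) + 2 * Real.pi / 3 * (lam N * ε N) * I N s =
      lam N * (T N s / 2 + 2 * Real.pi / 3 * ε N * I N s) := by ring
  rw [he, abs_mul, abs_of_nonneg hlam]
  calc lam N * |T N s / 2 + 2 * Real.pi / 3 * ε N * I N s|
      ≤ lam N * ((sphereMeasure : Measure (sphere (0 : V3) 1)).real univ / 2 * (|(2 * (Yb * R * R) * C * (KJ * (2 * Lb)) + (LY * R * R / 2 + Yb * R * Lb) * Θ * C * (1 + U))| + |6 * K * C|) *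
          ε N ^ 2) := mul_le_mul_of_nonneg_left hT hlam
    _ = (sphereMeasure : Measure (sphere (0 : V3) 1)).real univ / 2 * (|(2 * (Yb * R * R) * C * (KJ * (2 * Lb)) + (LY * R * R / 2 + Yb * R * Lb) * Θ * C * (1 + U))| + |6 * K * C|) *
          (lam N * ε N ^ 2) := by ring

end Main

end Summit.AtomisticToContinuum.HydrodynamicLimit.Theorems.EnskogAdjointDuality

end
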